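import Mathlib.Algebra.Order.BigOperators.Group.Finset
import Mathlib.Data.Real.Basic
import Mathlib.Tactic.Linarith
import Mathlib.Tactic.Ring
import Summits.HubbardSuperconductivity.HubbardSuperconductivity.Theorems.AnisotropyChordFourTorusPacking
import Summits.HubbardSuperconductivity.HubbardSuperconductivity.Theorems.AnisotropyChordFourTorusKernelLit

/-!
# Route `AnisotropyChord` / crux `FerroSideChord` at `M = 4`: THE TWO PSD CERTIFICATES, READ INTO `ℝ`
(prover seat `hubbard-h0-rotor-p1` g17)

* `psd_of_dominant_residual` — a symmetric integer matrix `A` with an integer factor `L` such that `E = q·A − L Lᵀ` is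
  diagonally dominant (`Σ_{j≠i} |E_ij| ≤ E_ii`) has `Σ_{i,j} v_i v_j A_ij ≥ 0` for every real `v` (`q > 0`);
* `quadLit D v := Σ_{i,j<58} v_i v_j · pLit D i j`;  **`quadLit_zero_nonneg`** (`D = 0`, kernel facts `certDom_zero`,
  `certSym_zero`) and **`quadLit_one_nonneg`** (`D = 1`: the deflated matrix `pLit 1 + 30` is certified by `certDom_one`,
  `certSym_one`, and `rowSum_one` = `30·M(1)·𝟙 = 0` removes the deflation).
-/

set_option linter.style.longLine false
set_option linter.dupNamespace false
set_option autoImplicit false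

open Finset

namespace Summit.HubbardSuperconductivity.HubbardSuperconductivity.Theorems.AnisotropyChord.FourTorus

/-! ## A generic PSD criterion -/

/-- **integer Cholesky factor with diagonally dominant residual ⇒ PSD.** [folklore] -/
theorem psd_of_dominant_residual (n : ℕ) (q : ℤ) (hq : 0 < q) (A L : ℕ → ℕ → ℤ)
    (hsym : ∀ i < n, ∀ j < n, A i j = A j i)
    (hdom : ∀ i < n, (∑ j ∈ range n, if j = i then 0 else |q * A i j - ∑ k ∈ range n, L i k * L j k|)
      ≤ q * A i i - ∑ k ∈ range n, L i k * L i k)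
    (v : ℕ → ℝ) : 0 ≤ ∑ i ∈ range n, ∑ j ∈ range n, v i * v j * (A i j : ℝ) := by
  -- the residual
  set E : ℕ → ℕ → ℝ := fun i j => (q : ℝ) * (A i j : ℝ) - ∑ k ∈ range n, (L i k : ℝ) * (L j k : ℝ) with hE
  have hEsym : ∀ i < n, ∀ j < n, E i j = E j i := by
    intro i hi j hj
    have h1 : (A i j : ℝ) = (A j i : ℝ) := by exact_mod_cast hsym i hi j hj
    have h2 : ∑ k ∈ range n, (L i k : ℝ) * (L j k : ℝ) = ∑ k ∈ range n, (L j k : ℝ) * (L i k : ℝ) :=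
      Finset.sum_congr rfl fun k _ => by ring
    show (q : ℝ) * (A i j : ℝ) - ∑ k ∈ range n, (L i k : ℝ) * (L j k : ℝ) = (q : ℝ) * (A j i : ℝ) - ∑ k ∈ range n, (L j k : ℝ) * (L i k : ℝ)
    rw [h1, h2]
  have hEdom : ∀ i < n, (∑ j ∈ range n, if j = i then 0 else |E i j|) ≤ E i i := by
    intro i hi
    have h := hdom i hi
    have hcast : ((∑ j ∈ range n, if j = i then 0 else |q * A i j - ∑ k ∈ range n, L i k * L j k| : ℤ) : ℝ)
        ≤ ((q * A i i - ∑ k ∈ range n, L i k * L i k : ℤ) : ℝ) := by exact_mod_cast h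
    push_cast at hcast
    have e1 : (∑ j ∈ range n, if j = i then 0 else |E i j|)
        = ∑ j ∈ range n, ((if j = i then 0 else |(q : ℝ) * (A i j : ℝ) - ∑ k ∈ range n, (L i k : ℝ) * (L j k : ℝ)|) : ℝ) :=
      Finset.sum_congr rfl fun j _ => by split_ifs <;> rfl
    rw [e1]
    convert hcast using 2 with j
  -- decomposition `q Σ v v A = Σ_k (Σ_i v_i L_ik)² + Σ v v E`
  have hdec : (q : ℝ) * ∑ i ∈ range n, ∑ j ∈ range n, v i * v j * (A i j : ℝ)
      = (∑ k ∈ range n, (∑ i ∈ range n, v i * (L i k : ℝ)) ^ 2) + ∑ i ∈ range n, ∑ j ∈ range n, v i * v j * E i j := by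
    have h1 : ∑ k ∈ range n, (∑ i ∈ range n, v i * (L i k : ℝ)) ^ 2
        = ∑ i ∈ range n, ∑ j ∈ range n, v i * v j * ∑ k ∈ range n, (L i k : ℝ) * (L j k : ℝ) := by
      simp_rw [sq, Finset.sum_mul_sum, Finset.mul_sum]
      rw [Finset.sum_comm]
      refine Finset.sum_congr rfl fun i _ => ?_
      rw [Finset.sum_comm]
      exact Finset.sum_congr rfl fun j _ => Finset.sum_congr rfl fun k _ => by ring
    rw [h1, ← Finset.sum_add_distrib, Finset.mul_sum]
    refine Finset.sum_congr rfl fun i _ => ?_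
    rw [← Finset.sum_add_distrib, Finset.mul_sum]
    exact Finset.sum_congr rfl fun j _ => by simp only [hE]; ring
  -- the residual form is non-negative by diagonal dominance
  have hEpos : 0 ≤ ∑ i ∈ range n, ∑ j ∈ range n, v i * v j * E i j := by
    -- split diagonal / off-diagonal and bound the off-diagonal part by `(v_i² + v_j²)/2 · |E_ij|`
    have hlow : ∀ i ∈ range n, v i ^ 2 * E i i - ∑ j ∈ range n, (if j = i then 0 else (v i ^ 2 + v j ^ 2) / 2 * |E i j|)
        ≤ ∑ j ∈ range n, v i * v j * E i j := by
      intro i hi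
      have hsplit : ∑ j ∈ range n, v i * v j * E i j
          = v i ^ 2 * E i i + ∑ j ∈ range n, (if j = i then 0 else v i * v j * E i j) := by
        rw [← Finset.add_sum_erase (range n) _ hi]
        congr 1
        · ring
        · rw [← Finset.sum_erase (range n) (f := fun j => if j = i then 0 else v i * v j * E i j) (a := i) (by simp)]
          exact Finset.sum_congr rfl fun j hj => by rw [if_neg (Finset.ne_of_mem_erase hj)]
      rw [hsplit]
      have hb : ∀ j ∈ range n, -(if j = i then 0 else (v i ^ 2 + v j ^ 2) / 2 * |E i j|) ≤ (if j = i then 0 else v i * v j * E i j) := by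
        intro j _
        split_ifs
        · simp
        · have h1 : -( (v i ^ 2 + v j ^ 2) / 2 * |E i j|) ≤ -|v i * v j| * |E i j| := by
            have : |v i * v j| ≤ (v i ^ 2 + v j ^ 2) / 2 := by
              rw [abs_mul]
              nlinarith [sq_nonneg (|v i| - |v j|), sq_abs (v i), sq_abs (v j), abs_nonneg (v i), abs_nonneg (v j)]
            nlinarith [abs_nonneg (E i j)]
          have h2 : -|v i * v j| * |E i j| ≤ v i * v j * E i j := by
            rw [neg_mul, ← abs_mul]; exact neg_abs_le _
          linarith
      have := Finset.sum_le_sum hb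
      rw [Finset.sum_neg_distrib] at this
      linarith
    have hsum := Finset.sum_le_sum hlow
    refine le_trans ?_ hsum
    -- `Σ_i [v_i² E_ii − Σ_{j≠i} (v_i²+v_j²)/2 |E_ij|] = Σ_i v_i² (E_ii − Σ_{j≠i} |E_ij|) ≥ 0`
    have hre : ∑ i ∈ range n, (v i ^ 2 * E i i - ∑ j ∈ range n, (if j = i then 0 else (v i ^ 2 + v j ^ 2) / 2 * |E i j|))
        = ∑ i ∈ range n, v i ^ 2 * (E i i - ∑ j ∈ range n, (if j = i then 0 else |E i j|)) := by
      have hhalf : ∑ i ∈ range n, ∑ j ∈ range n, (if j = i then 0 else v j ^ 2 / 2 * |E i j|)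
          = ∑ i ∈ range n, ∑ j ∈ range n, (if j = i then 0 else v i ^ 2 / 2 * |E i j|) := by
        rw [Finset.sum_comm]
        refine Finset.sum_congr rfl fun i hi => Finset.sum_congr rfl fun j hj => ?_
        by_cases h : i = j
        · subst h; simp
        · rw [if_neg h, if_neg (Ne.symm h), hEsym j (mem_range.1 hj) i (mem_range.1 hi)]
      have e1 : ∀ i ∈ range n, (v i ^ 2 * E i i - ∑ j ∈ range n, (if j = i then 0 else (v i ^ 2 + v j ^ 2) / 2 * |E i j|))
          = (v i ^ 2 * E i i - ∑ j ∈ range n, (if j = i then 0 else v i ^ 2 / 2 * |E i j|))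
            - ∑ j ∈ range n, (if j = i then 0 else v j ^ 2 / 2 * |E i j|) := by
        intro i _
        rw [sub_sub, ← Finset.sum_add_distrib]
        congr 1
        exact Finset.sum_congr rfl fun j _ => by split_ifs <;> ring
      rw [Finset.sum_congr rfl e1, Finset.sum_sub_distrib, hhalf, ← Finset.sum_sub_distrib]
      refine Finset.sum_congr rfl fun i _ => ?_
      have hS : v i ^ 2 * ∑ j ∈ range n, (if j = i then 0 else |E i j|)
          = (∑ j ∈ range n, (if j = i then 0 else v i ^ 2 / 2 * |E i j|)) + ∑ j ∈ range n, (if j = i then 0 else v i ^ 2 / 2 * |E i j|) := by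
        rw [Finset.mul_sum, ← Finset.sum_add_distrib]
        exact Finset.sum_congr rfl fun j _ => by split_ifs <;> ring
      have hm : v i ^ 2 * (E i i - ∑ j ∈ range n, (if j = i then 0 else |E i j|))
          = v i ^ 2 * E i i - v i ^ 2 * ∑ j ∈ range n, (if j = i then 0 else |E i j|) := mul_sub _ _ _
      linarith [hS, hm]
    rw [hre]
    exact Finset.sum_nonneg fun i hi => mul_nonneg (sq_nonneg _) (by linarith [hEdom i (mem_range.1 hi)])
  have hsq : 0 ≤ ∑ k ∈ range n, (∑ i ∈ range n, v i * (L i k : ℝ)) ^ 2 := Finset.sum_nonneg fun k _ => sq_nonneg _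
  have hqpos : (0 : ℝ) < q := by exact_mod_cast hq
  nlinarith [hdec, hEpos, hsq]

/-! ## Reading the kernel certificates -/

/-- the real quadratic form of the literal matrix `30·M(D)`. [folklore] -/
noncomputable def quadLit (D : ℕ) (v : ℕ → ℝ) : ℝ := ∑ i ∈ range 58, ∑ j ∈ range 58, v i * v j * (pLit D i j : ℝ)

/-- the residual entry as a `Finset` sum. [folklore] -/
theorem resid_eq (D i j : ℕ) : resid D i j = 2 ^ 32 * certMat D i j - ∑ k ∈ range 58, cholLit D i k * cholLit D j k := by
  unfold resid; rw [iter_add_eq, zero_add]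

/-- `certDom D = true`, unpacked. [folklore] -/
theorem dominant_of_certDom {D : ℕ} (h : certDom D = true) :
    ∀ i < 58, (∑ j ∈ range 58, if j = i then 0 else |(2 : ℤ) ^ 32 * certMat D i j - ∑ k ∈ range 58, cholLit D i k * cholLit D j k|)
      ≤ 2 ^ 32 * certMat D i i - ∑ k ∈ range 58, cholLit D i k * cholLit D i k := by
  intro i hi
  have hd := allN_sound h i hi
  rw [decide_eq_true_eq] at hd
  unfold offSum at hd
  rw [sumN_eq, resid_eq] at hd
  push_cast at hd
  refine le_trans (le_of_eq ?_) hd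
  refine Finset.sum_congr rfl fun j _ => ?_
  split_ifs
  · rfl
  · rw [resid_eq]

/-- `certSym D = true`, unpacked. [folklore] -/
theorem symm_of_certSym {D : ℕ} (h : certSym D = true) : ∀ i < 58, ∀ j < 58, pLit D i j = pLit D j i := by
  intro i hi j hj
  have := allN_sound (allN_sound h i hi) j hj
  rwa [beq_iff_eq] at this

/-- **`Δ = 0`: the literal matrix `30·M(0)` is positive semidefinite.** [folklore] -/
theorem quadLit_zero_nonneg (v : ℕ → ℝ) : 0 ≤ quadLit 0 v := by
  have h := psd_of_dominant_residual 58 (2 ^ 32) (by norm_num) (certMat 0) (cholLit 0)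
    (fun i hi j hj => by unfold certMat; rw [symm_of_certSym certSym_zero i hi j hj])
    (dominant_of_certDom certDom_zero) v
  unfold quadLit
  refine le_trans h (le_of_eq (Finset.sum_congr rfl fun i _ => Finset.sum_congr rfl fun j _ => ?_))
  unfold certMat; simp

/-- `rowSumZero = true`, unpacked: the rows of `pLit 1` sum to `0`. [folklore] -/
theorem rowSum_pLit_one : ∀ i < 58, ∑ j ∈ range 58, pLit 1 i j = 0 := by
  intro i hi
  have h := allN_sound rowSum_one i hi
  rw [beq_iff_eq, iter_add_eq, zero_add] at h
  exact h

/-- **`Δ = 1`: the literal matrix `30·M(1)` is positive semidefinite** (deflation by the constant vector). [folklore] -/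
theorem quadLit_one_nonneg (v : ℕ → ℝ) : 0 ≤ quadLit 1 v := by
  -- the deflated matrix `pLit 1 + 30` is PSD
  have hdefl : ∀ w : ℕ → ℝ, 0 ≤ ∑ i ∈ range 58, ∑ j ∈ range 58, w i * w j * ((pLit 1 i j : ℝ) + 30) := by
    intro w
    have h := psd_of_dominant_residual 58 (2 ^ 32) (by norm_num) (certMat 1) (cholLit 1)
      (fun i hi j hj => by unfold certMat; rw [symm_of_certSym certSym_one i hi j hj])
      (dominant_of_certDom certDom_one) w
    refine le_trans h (le_of_eq (Finset.sum_congr rfl fun i _ => Finset.sum_congr rfl fun j _ => ?_))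
    unfold certMat; push_cast; simp
  -- remove the mean: `v' = v − t`, `Σ v' = 0`
  set t : ℝ := (∑ i ∈ range 58, v i) / 58 with ht
  set w : ℕ → ℝ := fun i => v i - t with hw
  have hw0 : ∑ i ∈ range 58, w i = 0 := by
    simp only [hw, Finset.sum_sub_distrib, Finset.sum_const, Finset.card_range, nsmul_eq_mul, ht]; ring
  have hrow : ∀ i ∈ range 58, ∑ j ∈ range 58, (pLit 1 i j : ℝ) = 0 := by
    intro i hi; exact_mod_cast rowSum_pLit_one i (mem_range.1 hi)
  have hsym : ∀ i ∈ range 58, ∀ j ∈ range 58, (pLit 1 i j : ℝ) = (pLit 1 j i : ℝ) := by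
    intro i hi j hj; exact_mod_cast symm_of_certSym certSym_one i (mem_range.1 hi) j (mem_range.1 hj)
  have hcol : ∀ j ∈ range 58, ∑ i ∈ range 58, (pLit 1 i j : ℝ) = 0 := by
    intro j hj
    rw [Finset.sum_congr rfl (fun i hi => hsym i hi j hj)]
    exact hrow j hj
  -- `quadLit 1 v = Σ w w P`
  have hshift : quadLit 1 v = ∑ i ∈ range 58, ∑ j ∈ range 58, w i * w j * (pLit 1 i j : ℝ) := by
    unfold quadLit
    have e : ∀ i ∈ range 58, ∀ j ∈ range 58, w i * w j * (pLit 1 i j : ℝ)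
        = v i * v j * (pLit 1 i j : ℝ) - t * (v i * (pLit 1 i j : ℝ)) - t * (v j * (pLit 1 i j : ℝ)) + t ^ 2 * (pLit 1 i j : ℝ) := by
      intro i _ j _; simp only [hw]; ring
    rw [Finset.sum_congr rfl (fun i hi => Finset.sum_congr rfl (fun j hj => e i hi j hj))]
    simp only [Finset.sum_add_distrib, Finset.sum_sub_distrib]
    have z1 : ∑ i ∈ range 58, ∑ j ∈ range 58, t * (v i * (pLit 1 i j : ℝ)) = 0 := by
      rw [Finset.sum_eq_zero]; intro i hi
      rw [← Finset.mul_sum, ← Finset.mul_sum, hrow i hi]; ring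
    have z2 : ∑ i ∈ range 58, ∑ j ∈ range 58, t * (v j * (pLit 1 i j : ℝ)) = 0 := by
      rw [Finset.sum_comm, Finset.sum_eq_zero]; intro j hj
      rw [← Finset.mul_sum, ← Finset.mul_sum, hcol j hj]; ring
    have z3 : ∑ i ∈ range 58, ∑ j ∈ range 58, t ^ 2 * (pLit 1 i j : ℝ) = 0 := by
      rw [Finset.sum_eq_zero]; intro i hi
      rw [← Finset.mul_sum, hrow i hi]; ring
    rw [z1, z2, z3]; ring
  -- `Σ w w (P + 30) = Σ w w P + 30 (Σ w)² = Σ w w P`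
  have hplus : ∑ i ∈ range 58, ∑ j ∈ range 58, w i * w j * ((pLit 1 i j : ℝ) + 30)
      = (∑ i ∈ range 58, ∑ j ∈ range 58, w i * w j * (pLit 1 i j : ℝ)) + 30 * (∑ i ∈ range 58, w i) ^ 2 := by
    simp_rw [mul_add, Finset.sum_add_distrib]
    congr 1
    rw [sq, Finset.sum_mul_sum, Finset.mul_sum]
    exact Finset.sum_congr rfl fun i _ => by rw [Finset.mul_sum]; exact Finset.sum_congr rfl fun j _ => by ring
  have h := hdefl w
  rw [hplus, hw0] at h
  rw [hshift]
  linarith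

end Summit.HubbardSuperconductivity.HubbardSuperconductivity.Theorems.AnisotropyChord.FourTorus
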